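import Literature.IUT.HodgeTheaters.ProfiniteCompletionQuotients
import Mathlib.Data.ZMod.Basic
import Mathlib.GroupTheory.OrderOfElement
import HarnessLib

/-!
# [IUTchI] Theorem 2.6 (b): the lattice step "by projecting to `Ĝ^{ab}` … `γ ∈ G`"

Mochizuki, *Inter-universal Teichmüller theory I*, kurims manuscript (May 2020), §2, proof of Theorem 2.6,
nonabelian case, p. 57: "we conclude that `γ ∈ G · N_Ĝ(H_x) = G · Ĥ_x`, `γ ∈ G · N_Ĝ(H_y) = G · Ĥ_y`.
Thus, by projecting to `Ĝ^{ab}`, and applying the fact that `M` is of rank two, we conclude that `γ ∈ G`"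
[cite: Mochizuki2012, Thm 2.6 p.57].  This file isolates and PROVES the group-theoretic content of that
last step, componentwise in the finite quotients (no `Ẑ`-module theory): for a finite index subgroup
`G ≤ F`, elements `r, s ∈ G` and a homomorphism `f : G → ℤ` with `f(r) ≠ 0 = f(s)` (one half of "`M`
is of rank two"), if `ρ` lies in the closure of `η⟨r⟩` and `σ` in the closure of `η⟨s⟩` in `F̂` and
`σ ρ⁻¹ = η(g)`, then `ρ = η(r^c)` for an INTEGER `c` (`exists_eq_toCompletion_zpow`): reading the
relation in the finite quotients `G → ℤ → ℤ/m` pins the `Ẑ`-exponent of `ρ` to one residue class for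
all `m` at once.

Also here: components of points of the closure of `η⟨r⟩` are powers of `r` (`exists_val_eq_mk_zpow`);
`g ∈ G` automatically (`mem_of_toCompletion_eq_mul_inv`); finite-index normal subgroups of `F` below a
given finite-index normal subgroup of `G` (`exists_finiteIndexNormalSubgroup_le_map`).  Proof-only file.
-/

namespace Literature.IUT.HodgeTheaters.ProfiniteConjugates

open ProfiniteCompletion

universe u

variable {F : Type u} [Group F]

/-- Components of a point of the closure of `η⟨r⟩` in `F̂` are powers of `r`:
`ρ.val N = r^k · N`. [cite: Mochizuki2012, Thm 2.6 p.57] -/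
theorem exists_val_eq_mk_zpow {r : F} {ρ : profiniteCompletion F}
    (hρ : ρ ∈ closure (toCompletion F '' (Subgroup.zpowers r : Set F))) (N : FiniteIndexNormalSubgroup F) :
    ∃ k : ℤ, @Eq (F ⧸ N.toSubgroup) (ρ.val N) (QuotientGroup.mk (r ^ k)) := by
  have h := val_mem_map_of_mem_closure hρ N
  rw [MonoidHom.map_zpowers] at h
  obtain ⟨k, hk⟩ := Subgroup.mem_zpowers_iff.mp h
  have hk' : @Eq (F ⧸ N.toSubgroup) ((QuotientGroup.mk' N.toSubgroup r) ^ k) (ρ.val N) := hk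
  refine ⟨k, hk'.symm.trans ?_⟩
  rw [QuotientGroup.mk'_apply, QuotientGroup.mk_zpow]

/-- The component of `σ ρ⁻¹` at `N` from components of `σ` and `ρ`. [cite: Mochizuki2012, Thm 2.6 p.57] -/
theorem mul_inv_val_eq {ρ σ : profiniteCompletion F} (N : FiniteIndexNormalSubgroup F) {a b : F}
    (hρ : @Eq (F ⧸ N.toSubgroup) (ρ.val N) (QuotientGroup.mk a))
    (hσ : @Eq (F ⧸ N.toSubgroup) (σ.val N) (QuotientGroup.mk b)) :
    @Eq (F ⧸ N.toSubgroup) ((σ * ρ⁻¹).val N) (QuotientGroup.mk (b * a⁻¹)) := by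
  have e : (σ * ρ⁻¹).val N = σ.val N * (ρ.val N)⁻¹ := rfl
  rw [e, hρ, hσ]
  rfl

/-- An element `g ∈ F` with `η(g) = σ ρ⁻¹`, where `ρ`, `σ` lie in the closures of `η⟨r⟩`, `η⟨s⟩` with
`r, s ∈ G`, lies in `G` (read the relation at the normal core of `G`). [cite: Mochizuki2012, Thm 2.6 p.57] -/
theorem mem_of_toCompletion_eq_mul_inv (G : Subgroup F) [G.FiniteIndex] {r s g : F} (hr : r ∈ G)
    (hs : s ∈ G) {ρ σ : profiniteCompletion F}
    (hρ : ρ ∈ closure (toCompletion F '' (Subgroup.zpowers r : Set F)))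
    (hσ : σ ∈ closure (toCompletion F '' (Subgroup.zpowers s : Set F)))
    (hg : σ * ρ⁻¹ = toCompletion F g) : g ∈ G := by
  set N₀ : FiniteIndexNormalSubgroup F := FiniteIndexNormalSubgroup.ofSubgroup G.normalCore with hN₀
  obtain ⟨k, hk⟩ := exists_val_eq_mk_zpow hρ N₀
  obtain ⟨l, hl⟩ := exists_val_eq_mk_zpow hσ N₀
  have h1 := mul_inv_val_eq N₀ hk hl
  rw [hg] at h1
  have h1' : (QuotientGroup.mk g : F ⧸ N₀.toSubgroup) = QuotientGroup.mk (s ^ l * (r ^ k)⁻¹) := h1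
  have h2 : g⁻¹ * (s ^ l * (r ^ k)⁻¹) ∈ G.normalCore := by
    have := QuotientGroup.eq.mp h1'
    simpa [hN₀] using this
  have h3 : s ^ l * (r ^ k)⁻¹ * (g⁻¹ * (s ^ l * (r ^ k)⁻¹))⁻¹ = g := by group
  rw [← h3]
  exact G.mul_mem (G.mul_mem (G.zpow_mem hs l) (G.inv_mem (G.zpow_mem hr k)))
    (G.inv_mem (G.normalCore_le h2))

/-- For a finite-index normal subgroup `K` of a finite-index subgroup `G ≤ F` there is a finite-index
normal subgroup of `F` below it (its normal core in `F`). [cite: Mochizuki2012, Thm 2.6 p.57] -/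
theorem exists_finiteIndexNormalSubgroup_le_map (G : Subgroup F) [G.FiniteIndex] (K : Subgroup G)
    [K.Normal] [K.FiniteIndex] :
    ∃ N : FiniteIndexNormalSubgroup F, N.toSubgroup ≤ K.map G.subtype := by
  haveI : (K.map G.subtype).FiniteIndex := by
    constructor
    rw [Subgroup.index_map_subtype]
    exact mul_ne_zero Subgroup.FiniteIndex.index_ne_zero Subgroup.FiniteIndex.index_ne_zero
  exact ⟨FiniteIndexNormalSubgroup.ofSubgroup (K.map G.subtype).normalCore, Subgroup.normalCore_le _⟩

/-- **The congruences.**  With `G ≤ F` of finite index, `r, s, g ∈ G`, `f : G → ℤ` with `f(s) = 0`,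
`σ` in the closure of `η⟨s⟩` and `σ ρ⁻¹ = η(g)`: if `N` is a finite-index normal subgroup of `F` below
`Ker(G → ℤ → ℤ/m)` at which `ρ` has component `r^k`, then `f(g) + k·f(r) ≡ 0 (mod m)`.
[cite: Mochizuki2012, Thm 2.6 p.57] -/
theorem dvd_of_val_eq_mk_zpow (G : Subgroup F) {r s g : F} (hr : r ∈ G) (hs : s ∈ G) (hgG : g ∈ G)
    (f : G →* Multiplicative ℤ) (hfs : f ⟨s, hs⟩ = 1)
    {ρ σ : profiniteCompletion F}
    (hσ : σ ∈ closure (toCompletion F '' (Subgroup.zpowers s : Set F)))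
    (hg : σ * ρ⁻¹ = toCompletion F g) (m : ℕ) (N : FiniteIndexNormalSubgroup F)
    (hN : N.toSubgroup ≤ (((Int.castAddHom (ZMod m)).toMultiplicative.comp f).ker).map G.subtype)
    (k : ℤ) (hk : @Eq (F ⧸ N.toSubgroup) (ρ.val N) (QuotientGroup.mk (r ^ k))) :
    (m : ℤ) ∣ Multiplicative.toAdd (f ⟨g, hgG⟩) + k * Multiplicative.toAdd (f ⟨r, hr⟩) := by
  set φ : G →* Multiplicative (ZMod m) := (Int.castAddHom (ZMod m)).toMultiplicative.comp f with hφ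
  have hφapply : ∀ x : G, Multiplicative.toAdd (φ x) = ((Multiplicative.toAdd (f x) : ℤ) : ZMod m) := by
    intro x; simp [hφ]
  obtain ⟨l, hl⟩ := exists_val_eq_mk_zpow hσ N
  have h1 := mul_inv_val_eq N hk hl
  rw [hg] at h1
  have h1' : (QuotientGroup.mk g : F ⧸ N.toSubgroup) = QuotientGroup.mk (s ^ l * (r ^ k)⁻¹) := h1
  have h2 : g⁻¹ * (s ^ l * (r ^ k)⁻¹) ∈ (φ.ker).map G.subtype := hN (QuotientGroup.eq.mp h1')
  -- pull back to `G`
  set R : G := ⟨r, hr⟩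
  set S : G := ⟨s, hs⟩
  set Gg : G := ⟨g, hgG⟩
  have h3 : Gg⁻¹ * (S ^ l * (R ^ k)⁻¹) ∈ φ.ker := by
    obtain ⟨w, hw, hw'⟩ := h2
    have : w = Gg⁻¹ * (S ^ l * (R ^ k)⁻¹) := Subtype.ext (by simpa [R, S, Gg] using hw')
    rw [← this]; exact hw
  rw [MonoidHom.mem_ker, map_mul, map_inv, map_mul, map_inv, map_zpow, map_zpow] at h3
  have hφS : φ S = 1 := by simp [hφ, hfs]
  rw [hφS, one_zpow, one_mul, inv_mul_eq_one, eq_inv_iff_mul_eq_one] at h3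
  -- read additively in `ZMod m`
  have h4 := congrArg Multiplicative.toAdd h3
  rw [toAdd_mul, toAdd_zpow, toAdd_one, hφapply, hφapply] at h4
  rw [← ZMod.intCast_zmod_eq_zero_iff_dvd]
  push_cast
  rw [← h4]
  ring

/-- **The lattice step of Theorem 2.6 (b).**  Let `G ≤ F` have finite index, `r, s ∈ G`, and let
`f : G → ℤ` be a homomorphism with `f(r) ≠ 0` and `f(s) = 0`.  If `ρ` lies in the closure of `η⟨r⟩`
and `σ` in the closure of `η⟨s⟩` in `F̂`, and `σ ρ⁻¹ = η(g)` for some `g ∈ F`, then `ρ = η(r^c)` for an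
integer `c` — "by projecting to `Ĝ^{ab}`, and applying the fact that `M` is of rank two, we conclude
that `γ ∈ G`" (p. 57). [cite: Mochizuki2012, Thm 2.6 p.57] -/
theorem exists_eq_toCompletion_zpow (G : Subgroup F) [G.FiniteIndex] {r s g : F} (hr : r ∈ G)
    (hs : s ∈ G) (f : G →* Multiplicative ℤ) (hfr : f ⟨r, hr⟩ ≠ 1) (hfs : f ⟨s, hs⟩ = 1)
    {ρ σ : profiniteCompletion F}
    (hρ : ρ ∈ closure (toCompletion F '' (Subgroup.zpowers r : Set F)))
    (hσ : σ ∈ closure (toCompletion F '' (Subgroup.zpowers s : Set F)))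
    (hg : σ * ρ⁻¹ = toCompletion F g) :
    ∃ c : ℤ, ρ = toCompletion F (r ^ c) := by
  have hgG : g ∈ G := mem_of_toCompletion_eq_mul_inv G hr hs hρ hσ hg
  set d : ℤ := Multiplicative.toAdd (f ⟨r, hr⟩) with hd
  set a : ℤ := Multiplicative.toAdd (f ⟨g, hgG⟩) with ha
  have hd0 : d ≠ 0 := fun h => hfr (by
    rw [hd] at h
    exact toAdd_eq_zero.mp h)
  -- the finite quotients `G → ℤ/m` and finite-index normal subgroups of `F` below their kernels
  have key : ∀ m : ℕ, m ≠ 0 → ∀ N' : FiniteIndexNormalSubgroup F, ∃ N : FiniteIndexNormalSubgroup F,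
      N ≤ N' ∧ ∀ k : ℤ, @Eq (F ⧸ N.toSubgroup) (ρ.val N) (QuotientGroup.mk (r ^ k)) → (m : ℤ) ∣ a + k * d := by
    intro m hm N'
    haveI : NeZero m := ⟨hm⟩
    set φ : G →* Multiplicative (ZMod m) := (Int.castAddHom (ZMod m)).toMultiplicative.comp f with hφ
    haveI : φ.ker.FiniteIndex := Subgroup.finiteIndex_ker φ
    obtain ⟨N₁, hN₁⟩ := exists_finiteIndexNormalSubgroup_le_map G φ.ker
    refine ⟨N₁ ⊓ N', inf_le_right, fun k hk => ?_⟩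
    exact dvd_of_val_eq_mk_zpow G hr hs hgG f hfs hσ hg m (N₁ ⊓ N')
      (le_trans (inf_le_left : (N₁ ⊓ N' : FiniteIndexNormalSubgroup F) ≤ N₁) hN₁) k hk
  -- Step A: `d ∣ a`
  obtain ⟨c', hc'⟩ : d ∣ a := by
    obtain ⟨N, -, hN⟩ := key d.natAbs (Int.natAbs_ne_zero.mpr hd0)
      (FiniteIndexNormalSubgroup.ofSubgroup G.normalCore)
    obtain ⟨k, hk⟩ := exists_val_eq_mk_zpow hρ N
    have h1 : (d.natAbs : ℤ) ∣ a + k * d := hN k hk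
    rw [Int.natAbs_dvd] at h1
    have h2 : d ∣ k * d := dvd_mul_left d k
    exact (dvd_add_left h2).mp h1
  -- Step B: every component of `ρ` is the component of `η(r ^ (-c'))`
  refine ⟨-c', Subtype.ext (funext fun N => ?_)⟩
  change @Eq (F ⧸ N.toSubgroup) (ρ.val N) (QuotientGroup.mk (r ^ (-c')))
  set e : ℕ := orderOf (QuotientGroup.mk r : F ⧸ N.toSubgroup) with he
  have he0 : 0 < e := (isOfFinOrder_of_finite _).orderOf_pos
  obtain ⟨M, hMN, hM⟩ := key (d.natAbs * e)
    (mul_ne_zero (Int.natAbs_ne_zero.mpr hd0) he0.ne') N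
  obtain ⟨k, hk⟩ := exists_val_eq_mk_zpow hρ M
  have hkN : @Eq (F ⧸ N.toSubgroup) (ρ.val N) (QuotientGroup.mk (r ^ k)) := val_mk_eq_of_le ρ hMN _ hk
  have hdiv : ((d.natAbs * e : ℕ) : ℤ) ∣ a + k * d := hM k hk
  -- `e ∣ c' + k`
  have hediv : (e : ℤ) ∣ c' + k := by
    rw [hc', ← mul_comm d k, ← mul_add] at hdiv
    have h1 : (d.natAbs : ℤ) * e ∣ d * (c' + k) := by exact_mod_cast hdiv
    rw [← Int.natAbs_dvd_natAbs, Int.natAbs_mul, Int.natAbs_mul, Int.natAbs_natCast,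
      Int.natAbs_natCast] at h1
    have h2 : e ∣ (c' + k).natAbs := Nat.dvd_of_mul_dvd_mul_left (Int.natAbs_pos.mpr hd0) h1
    have h3 : (e : ℤ) ∣ ((c' + k).natAbs : ℤ) := Int.natCast_dvd_natCast.mpr h2
    exact Int.dvd_natAbs.mp h3
  rw [hkN, QuotientGroup.mk_zpow, QuotientGroup.mk_zpow, zpow_eq_zpow_iff_modEq, ← he]
  refine Int.modEq_iff_dvd.mpr ?_
  have : -c' - k = -(c' + k) := by ring
  rw [this]
  exact (dvd_neg).mpr hediv

end Literature.IUT.HodgeTheaters.ProfiniteConjugates
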